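import Literature.NumberTheory.Sieve.SmoothArcClassesCRT
import HarnessLib

/-!
# The singular series of the parity-class friable ternary problem: definitions, CRT structure

Topic `Literature/NumberTheory/Sieve`; a PROVED algebraic tool file continuing `SmoothArcClasses*`
([MontgomeryVaughanActa1975, §5–6], [Harper2016, §2.2]). For the ternary additive problem
`d₁ n₁ + σ d₂ n₂ = n₃` (`σ = ±1`) in friable integers with `n₁, n₂` ODD and `n₃` free, the circle method with
the class-restricted local factors `LF = classLocalFactor α` of `SmoothArcClasses` produces the singular series
`𝔖 = Σ_{k ≥ 1} Σ_{a mod k}^* LF(2,1,k; d₁a) LF(2,1,k; σd₂a) conj LF(1,0,k; a)`. This file contains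

* the definitions `paritySingTerm` (the `k`-th term), `paritySingSeries` (`𝔖`, a `tsum`), `parityLocalOdd p`
  (`Σ_j` of the modulus-one terms at `p^j`), `parityLocalTwo` (`Σ_j paritySingTerm (2^j)`), and the auxiliary
  `parityMixedTerm m` (modulus `m` on the odd variables) / `parityUnitTerm` (modulus `1`, the "unit term" `T(k)`);
* invariances of `classLocalFactor`: periodicity in `h mod k` (`classLocalFactor_congr_zmod`), irrelevance of the
  class for `m = 1`, `LF(1,·,k; hu) = LF(1,·,k; h)` for units `u` (`classLocalFactor_one_mul_unit`, via
  `c_q(hu) = c_q(h)`, `ramanujanSum_mul_of_coprime_right`), and the unit reindexing `sum_coprime_comp_mul_mod`;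
* **(S2) CRT multiplicativity** `parityMixedTerm_mul_of_coprime`: for coprime `k₁, k₂` with `(m, k₂) = 1`,
  `parityMixedTerm m (k₁k₂) = parityMixedTerm m k₁ · parityUnitTerm k₂`; hence
  `paritySingTerm (k₁k₂) = paritySingTerm k₁ · parityUnitTerm k₂` (`k₂` odd) and `parityUnitTerm` is multiplicative;
* the closed form `parityUnitTerm_eq`: `T(k) = φ(k) · LF(1,0,k; d₁) LF(1,0,k; d₂) G_α(k)` for `σ = ±1`.

The `2`-adic factor, the prime-power structure and all bounds are in `SmoothParitySingularLocal`,
`SmoothParitySingularMajorant`, `SmoothParitySingularBounds`. The term at `k = 0` is an empty sum (`= 0`).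

## References

* H. L. Montgomery, R. C. Vaughan, *The exceptional set in Goldbach's problem*, Acta Arith. 27 (1975), §5–6
  (singular series of a ternary problem with congruence conditions; local factors) [MontgomeryVaughanActa1975].
* A. J. Harper, Compositio Math. 152 (2016), §2.2, §5 (the smooth local factors `G_α`, `H_α`) [Harper2016].
* H. L. Montgomery, R. C. Vaughan, *Multiplicative Number Theory I* (2007), Thm 4.1 (Ramanujan sums), §1.3
  (Euler products) [MontgomeryVaughan2007].
-/

noncomputable section

open Finset Real Complex
open scoped ArithmeticFunction.Moebius FourierTransform

namespace Literature.NumberTheory.Sieve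

namespace SmoothArcs

/-! ### Definitions -/

/-- The `k`-th term of the singular series of the parity-class ternary problem `d₁n₁ + σ d₂n₂ = n₃`
(`n₁, n₂` odd, `n₃` free): `Σ_{a mod k}^* LF(2,1,k; d₁a) LF(2,1,k; σd₂a) conj LF(1,0,k; a)`
(`LF = classLocalFactor α`; the `k = 0` term is an empty sum). [cite: MontgomeryVaughanActa1975, §6] -/
def paritySingTerm (α : ℝ) (σ : ℤ) (d₁ d₂ : ℕ) (k : ℕ) : ℂ :=
  ∑ a ∈ (Finset.range k).filter (Nat.Coprime k),
    classLocalFactor α 2 1 k (d₁ * a) * classLocalFactor α 2 1 k (σ * (d₂ * a)) *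
      starRingEnd ℂ (classLocalFactor α 1 0 k a)

/-- The singular series `𝔖 = Σ_{k ≥ 1} paritySingTerm k` (the `k = 0` term is an empty sum).
[cite: MontgomeryVaughanActa1975, §6] -/
def paritySingSeries (α : ℝ) (σ : ℤ) (d₁ d₂ : ℕ) : ℂ := ∑' k : ℕ, paritySingTerm α σ d₁ d₂ k

/-- The odd-prime local factor `E_p = Σ_{j ≥ 0} Σ_{a mod p^j}^* G(p^j; d₁a) G(p^j; σd₂a) conj G(p^j; a)` with the
class-free factors (modulus `1`). [cite: MontgomeryVaughanActa1975, §6] -/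
def parityLocalOdd (α : ℝ) (σ : ℤ) (d₁ d₂ p : ℕ) : ℂ :=
  ∑' j : ℕ, ∑ a ∈ (Finset.range (p ^ j)).filter (Nat.Coprime (p ^ j)),
    classLocalFactor α 1 0 (p ^ j) (d₁ * a) * classLocalFactor α 1 0 (p ^ j) (σ * (d₂ * a)) *
      starRingEnd ℂ (classLocalFactor α 1 0 (p ^ j) a)

/-- The `2`-adic factor (modulus `2`, class `1` on the two odd variables): `Σ_{j ≥ 0} paritySingTerm (2^j)`.
[cite: MontgomeryVaughanActa1975, §6] -/
def parityLocalTwo (α : ℝ) (σ : ℤ) (d₁ d₂ : ℕ) : ℂ :=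
  ∑' j : ℕ, ∑ a ∈ (Finset.range (2 ^ j)).filter (Nat.Coprime (2 ^ j)),
    classLocalFactor α 2 1 (2 ^ j) (d₁ * a) * classLocalFactor α 2 1 (2 ^ j) (σ * (d₂ * a)) *
      starRingEnd ℂ (classLocalFactor α 1 0 (2 ^ j) a)

/-- The general mixed term with modulus `m` (class `1`) on the two odd variables:
`Σ_{a mod k}^* LF(m,1,k; d₁a) LF(m,1,k; σd₂a) conj LF(1,0,k; a)`; `m = 2` is `paritySingTerm`,
`m = 1` the class-free unit term `parityUnitTerm`. [folklore] -/
def parityMixedTerm (α : ℝ) (m : ℕ) (σ : ℤ) (d₁ d₂ : ℕ) (k : ℕ) : ℂ :=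
  ∑ a ∈ (Finset.range k).filter (Nat.Coprime k),
    classLocalFactor α m 1 k (d₁ * a) * classLocalFactor α m 1 k (σ * (d₂ * a)) *
      starRingEnd ℂ (classLocalFactor α 1 0 k a)

/-- The class-free unit term `T(k) = Σ_{a mod k}^* G(k; d₁a) G(k; σd₂a) conj G(k; a)` (modulus `1`), the
`k`-th coefficient of the odd part of the singular series. [folklore] -/
def parityUnitTerm (α : ℝ) (σ : ℤ) (d₁ d₂ : ℕ) (k : ℕ) : ℂ :=
  ∑ a ∈ (Finset.range k).filter (Nat.Coprime k),
    classLocalFactor α 1 0 k (d₁ * a) * classLocalFactor α 1 0 k (σ * (d₂ * a)) *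
      starRingEnd ℂ (classLocalFactor α 1 0 k a)

/-! ### Elementary invariances of `classLocalFactor` -/

/-- `classLocalFactor α m r k h` depends on `h` only modulo `k`. [folklore] -/
theorem classLocalFactor_congr_zmod (α : ℝ) (m r k : ℕ) {h h' : ℤ} (hh : h ≡ h' [ZMOD k]) :
    classLocalFactor α m r k h = classLocalFactor α m r k h' := by
  rcases eq_or_ne k 0 with rfl | hk
  · simp [classLocalFactor]
  obtain ⟨c, hc⟩ := Int.modEq_iff_dvd.mp hh
  unfold classLocalFactor
  refine Finset.sum_congr rfl fun t _ => ?_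
  congr 1
  have hk' : (k : ℝ) ≠ 0 := by exact_mod_cast hk
  have e1 : (h' * t : ℝ) / k = (h * t : ℝ) / k + ((c * t : ℤ) : ℝ) := by
    have : (h' : ℝ) = h + k * c := by exact_mod_cast (by linear_combination hc : h' = h + k * c)
    rw [this]; push_cast; field_simp
  rw [e1, AddChar.map_add_eq_mul, Circle.coe_mul, RamanujanSum.fourierChar_intCast, mul_one]

/-- For modulus `m = 1` the class `r` is irrelevant. [folklore] -/
theorem classLocalFactor_one_eq_classLocalFactor_one_zero (α : ℝ) (r k : ℕ) (h : ℤ) :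
    classLocalFactor α 1 r k h = classLocalFactor α 1 0 k h := by
  unfold classLocalFactor
  rw [Finset.filter_true_of_mem (fun n _ => Nat.modEq_one), Finset.filter_true_of_mem (fun n _ => Nat.modEq_one)]

/-- `paritySingTerm` is the mixed term with modulus `2`. [folklore] -/
theorem paritySingTerm_eq_parityMixedTerm (α : ℝ) (σ : ℤ) (d₁ d₂ k : ℕ) :
    paritySingTerm α σ d₁ d₂ k = parityMixedTerm α 2 σ d₁ d₂ k := rfl

/-- `parityUnitTerm` is the mixed term with modulus `1`. [folklore] -/
theorem parityUnitTerm_eq_parityMixedTerm (α : ℝ) (σ : ℤ) (d₁ d₂ k : ℕ) :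
    parityUnitTerm α σ d₁ d₂ k = parityMixedTerm α 1 σ d₁ d₂ k := by
  unfold parityUnitTerm parityMixedTerm
  simp_rw [classLocalFactor_one_eq_classLocalFactor_one_zero α 1]

/-- Multiplication by a unit `u` mod `k` (`u v ≡ 1`) permutes the reduced residues:
`Σ_{a mod k}^* f(a u mod k) = Σ_{a mod k}^* f(a)`. [folklore] -/
theorem sum_coprime_comp_mul_mod {M : Type*} [AddCommMonoid M] {k u v : ℕ} (hk : k ≠ 0)
    (huv : u * v ≡ 1 [MOD k]) (f : ℕ → M) :
    ∑ a ∈ (Finset.range k).filter (Nat.Coprime k), f (a * u % k) =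
      ∑ a ∈ (Finset.range k).filter (Nat.Coprime k), f a := by
  have hu : u.Coprime k := Nat.coprime_of_mul_modEq_one v huv
  have hv : v.Coprime k := Nat.coprime_of_mul_modEq_one u (by rwa [mul_comm] at huv)
  have key : ∀ a b : ℕ, b.Coprime k → ((a * b % k) ∈ (Finset.range k).filter (Nat.Coprime k) ↔
      a.Coprime k) := by
    intro a b hb
    simp only [Finset.mem_filter, Finset.mem_range, Nat.mod_lt _ (Nat.pos_of_ne_zero hk), true_and]
    rw [Nat.Coprime, Nat.gcd_comm, ← Nat.gcd_rec, Nat.gcd_comm]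
    exact ⟨fun h => Nat.Coprime.coprime_mul_right h, fun h => Nat.Coprime.mul_left h hb⟩
  have hround : ∀ a : ℕ, a < k → a * u % k * v % k = a := by
    intro a ha
    rw [Nat.mod_mul_mod, mul_assoc]
    have : a * (u * v) ≡ a * 1 [MOD k] := Nat.ModEq.mul_left a huv
    rw [mul_one] at this
    rw [this, Nat.mod_eq_of_lt ha]
  have hround' : ∀ a : ℕ, a < k → a * v % k * u % k = a := by
    intro a ha
    rw [Nat.mod_mul_mod, mul_assoc]
    have : a * (v * u) ≡ a * 1 [MOD k] := Nat.ModEq.mul_left a (by rwa [mul_comm] at huv)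
    rw [mul_one] at this
    rw [this, Nat.mod_eq_of_lt ha]
  refine Finset.sum_nbij' (fun a => a * u % k) (fun a => a * v % k) ?_ ?_ ?_ ?_ (fun _ _ => rfl)
  · intro a ha
    obtain ⟨-, hak⟩ := Finset.mem_filter.mp ha
    exact (key a u hu).mpr hak.symm
  · intro a ha
    obtain ⟨-, hak⟩ := Finset.mem_filter.mp ha
    exact (key a v hv).mpr hak.symm
  · intro a ha
    exact hround a (Finset.mem_range.mp (Finset.mem_filter.mp ha).1)
  · intro a ha
    exact hround' a (Finset.mem_range.mp (Finset.mem_filter.mp ha).1)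

/-- For coprime `k₁, k₂` with `k₁ ≥ 1` there is a natural number `u` with `u k₂ ≡ 1 (mod k₁)`. [folklore] -/
theorem exists_nat_mul_modEq_one {k₁ k₂ : ℕ} (hk : k₁.Coprime k₂) (hk₁ : k₁ ≠ 0) :
    ∃ u : ℕ, u * k₂ ≡ 1 [MOD k₁] := by
  rcases eq_or_ne k₁ 1 with rfl | h1
  · exact ⟨0, Nat.modEq_one⟩
  obtain ⟨u, -, hu⟩ := Nat.exists_mul_mod_eq_one_of_coprime hk.symm (by omega)
  refine ⟨u, ?_⟩
  rw [Nat.ModEq, mul_comm, hu, Nat.mod_eq_of_lt (by omega)]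

/-! ### CRT multiplicativity -/

/-- **CRT multiplicativity of the mixed term.** For `m ≥ 1` and coprime `k₁, k₂` with `(m, k₂) = 1`:
`parityMixedTerm m (k₁k₂) = parityMixedTerm m k₁ · parityMixedTerm 1 k₂` (`classLocalFactor_mul_of_coprime` for the
three factors, CRT on the units `a mod k₁k₂`, and the unit twists `u₁, u₂` absorbed by reindexing). [folklore] -/
theorem parityMixedTerm_mul_of_coprime (α : ℝ) {m : ℕ} (hm : m ≠ 0) (σ : ℤ) (d₁ d₂ : ℕ) {k₁ k₂ : ℕ}
    (hk : k₁.Coprime k₂) (hmk : m.Coprime k₂) :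
    parityMixedTerm α m σ d₁ d₂ (k₁ * k₂) = parityMixedTerm α m σ d₁ d₂ k₁ * parityMixedTerm α 1 σ d₁ d₂ k₂ := by
  rcases eq_or_ne k₁ 0 with rfl | hk₁
  · simp [parityMixedTerm]
  rcases eq_or_ne k₂ 0 with rfl | hk₂
  · simp [parityMixedTerm]
  obtain ⟨u₁, hu₁⟩ := exists_nat_mul_modEq_one hk hk₁
  obtain ⟨u₂, hu₂⟩ := exists_nat_mul_modEq_one hk.symm hk₂
  have hu₁' : (u₁ : ℤ) * k₂ ≡ 1 [ZMOD k₁] := by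
    have := Int.natCast_modEq_iff.mpr hu₁; push_cast at this; exact this
  have hu₂' : (u₂ : ℤ) * k₁ ≡ 1 [ZMOD k₂] := by
    have := Int.natCast_modEq_iff.mpr hu₂; push_cast at this; exact this
  have hcm : (k₁ * m).Coprime (k₂ * 1) := by rw [mul_one]; exact Nat.Coprime.mul_left hk hmk
  have hc1 : (k₁ * 1).Coprime (k₂ * 1) := by simpa using hk
  have A : ∀ h : ℤ, classLocalFactor α m 1 (k₁ * k₂) h =
      classLocalFactor α m 1 k₁ (h * u₁) * classLocalFactor α 1 1 k₂ (h * u₂) := fun h => by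
    simpa using classLocalFactor_mul_of_coprime α hk₁ hk₂ hm one_ne_zero hcm 1 hu₁' hu₂' (h := h)
  have B : ∀ h : ℤ, classLocalFactor α 1 0 (k₁ * k₂) h =
      classLocalFactor α 1 0 k₁ (h * u₁) * classLocalFactor α 1 0 k₂ (h * u₂) := fun h => by
    simpa using classLocalFactor_mul_of_coprime α hk₁ hk₂ one_ne_zero one_ne_zero hc1 0 hu₁' hu₂' (h := h)
  -- periodicity: the twisted frequencies only matter modulo the level
  have hper : ∀ (k u a : ℕ) (c : ℤ), c * ((a * u % k : ℕ) : ℤ) ≡ c * a * u [ZMOD k] := by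
    intro k u a c
    rw [Int.natCast_mod, Nat.cast_mul, mul_assoc]
    exact Int.ModEq.mul_left c (Int.mod_modEq _ _)
  have hΦ : ∀ (k u mm rr a : ℕ),
      classLocalFactor α mm rr k (d₁ * a * u) * classLocalFactor α mm rr k (σ * (d₂ * a) * u) *
        starRingEnd ℂ (classLocalFactor α 1 0 k (a * u)) =
      classLocalFactor α mm rr k (d₁ * (a * u % k : ℕ)) * classLocalFactor α mm rr k (σ * (d₂ * (a * u % k : ℕ))) *
        starRingEnd ℂ (classLocalFactor α 1 0 k (a * u % k : ℕ)) := by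
    intro k u mm rr a
    have e2 : σ * (d₂ * a) * u ≡ σ * (d₂ * (a * u % k : ℕ)) [ZMOD k] := by
      have := (hper k u a (σ * d₂)).symm
      rwa [show σ * (d₂ : ℤ) * a * u = σ * (d₂ * a) * u by ring,
        show σ * (d₂ : ℤ) * ((a * u % k : ℕ) : ℤ) = σ * (d₂ * ((a * u % k : ℕ) : ℤ)) by ring] at this
    have e3 : (a : ℤ) * u ≡ ((a * u % k : ℕ) : ℤ) [ZMOD k] := by simpa using (hper k u a 1).symm
    rw [classLocalFactor_congr_zmod α mm rr k (hper k u a d₁).symm, classLocalFactor_congr_zmod α mm rr k e2,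
      classLocalFactor_congr_zmod α 1 0 k e3]
  set Φ₁ : ℕ → ℂ := fun b => classLocalFactor α m 1 k₁ (d₁ * b) * classLocalFactor α m 1 k₁ (σ * (d₂ * b)) *
      starRingEnd ℂ (classLocalFactor α 1 0 k₁ b) with hΦ₁
  set Φ₂ : ℕ → ℂ := fun b => classLocalFactor α 1 1 k₂ (d₁ * b) * classLocalFactor α 1 1 k₂ (σ * (d₂ * b)) *
      starRingEnd ℂ (classLocalFactor α 1 0 k₂ b) with hΦ₂
  have hsummand : ∀ a : ℕ, classLocalFactor α m 1 (k₁ * k₂) (d₁ * a) *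
      classLocalFactor α m 1 (k₁ * k₂) (σ * (d₂ * a)) * starRingEnd ℂ (classLocalFactor α 1 0 (k₁ * k₂) a) =
      Φ₁ (a * u₁ % k₁) * Φ₂ (a * u₂ % k₂) := by
    intro a
    rw [A, A, B, map_mul]
    simp only [hΦ₁, hΦ₂]
    rw [← hΦ k₁ u₁ m 1 a, ← hΦ k₂ u₂ 1 1 a]
    ring
  have hcop : ∀ a : ℕ, Nat.Coprime (k₁ * k₂) a ↔ Nat.Coprime k₁ (a % k₁) ∧ Nat.Coprime k₂ (a % k₂) := by
    intro a
    rw [Nat.coprime_mul_iff_left]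
    have e : ∀ k : ℕ, Nat.Coprime k a ↔ Nat.Coprime k (a % k) := fun k => by
      unfold Nat.Coprime; rw [Nat.gcd_rec k a, Nat.gcd_comm]
    rw [e k₁, e k₂]
  calc parityMixedTerm α m σ d₁ d₂ (k₁ * k₂)
      = ∑ a ∈ (Finset.range (k₁ * k₂)).filter (Nat.Coprime (k₁ * k₂)), Φ₁ (a * u₁ % k₁) * Φ₂ (a * u₂ % k₂) :=
        Finset.sum_congr rfl fun a _ => hsummand a
    _ = ∑ a ∈ Finset.range (k₁ * k₂), (if Nat.Coprime k₁ (a % k₁) ∧ Nat.Coprime k₂ (a % k₂) then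
          Φ₁ (a % k₁ * u₁ % k₁) * Φ₂ (a % k₂ * u₂ % k₂) else 0) := by
        rw [Finset.sum_filter]
        refine Finset.sum_congr rfl fun a _ => ?_
        rw [Nat.mod_mul_mod, Nat.mod_mul_mod]
        exact if_congr (hcop a) rfl rfl
    _ = ∑ t₁ ∈ Finset.range k₁, ∑ t₂ ∈ Finset.range k₂, (if Nat.Coprime k₁ t₁ ∧ Nat.Coprime k₂ t₂ then
          Φ₁ (t₁ * u₁ % k₁) * Φ₂ (t₂ * u₂ % k₂) else 0) := by
        have := sum_filter_modEq_crt (m₁ := 1) (m₂ := 1) hk hk₁ hk₂ (one_dvd _) (one_dvd _) 0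
          (fun t₁ t₂ => if Nat.Coprime k₁ t₁ ∧ Nat.Coprime k₂ t₂ then Φ₁ (t₁ * u₁ % k₁) * Φ₂ (t₂ * u₂ % k₂) else 0)
        simpa [Nat.modEq_one, Finset.filter_true_of_mem] using this
    _ = (∑ t₁ ∈ (Finset.range k₁).filter (Nat.Coprime k₁), Φ₁ (t₁ * u₁ % k₁)) *
          ∑ t₂ ∈ (Finset.range k₂).filter (Nat.Coprime k₂), Φ₂ (t₂ * u₂ % k₂) := by
        rw [Finset.sum_filter, Finset.sum_filter, Finset.sum_mul_sum]
        refine Finset.sum_congr rfl fun t₁ _ => Finset.sum_congr rfl fun t₂ _ => ?_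
        by_cases h₁ : Nat.Coprime k₁ t₁
        · by_cases h₂ : Nat.Coprime k₂ t₂
          · rw [if_pos ⟨h₁, h₂⟩, if_pos h₁, if_pos h₂]
          · rw [if_neg (fun h => h₂ h.2), if_neg h₂, mul_zero]
        · rw [if_neg (fun h => h₁ h.1), if_neg h₁, zero_mul]
    _ = parityMixedTerm α m σ d₁ d₂ k₁ * parityMixedTerm α 1 σ d₁ d₂ k₂ := by
        rw [sum_coprime_comp_mul_mod hk₁ hu₁ Φ₁, sum_coprime_comp_mul_mod hk₂ hu₂ Φ₂]
        rfl

/-- **Multiplicativity of the singular-series terms**: for coprime `k₁, k₂` with `k₂` odd,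
`paritySingTerm (k₁k₂) = paritySingTerm k₁ · parityUnitTerm k₂`. [folklore] -/
theorem paritySingTerm_mul_of_coprime (α : ℝ) (σ : ℤ) (d₁ d₂ : ℕ) {k₁ k₂ : ℕ} (hk : k₁.Coprime k₂)
    (hk₂ : Odd k₂) :
    paritySingTerm α σ d₁ d₂ (k₁ * k₂) = paritySingTerm α σ d₁ d₂ k₁ * parityUnitTerm α σ d₁ d₂ k₂ := by
  rw [paritySingTerm_eq_parityMixedTerm, paritySingTerm_eq_parityMixedTerm, parityUnitTerm_eq_parityMixedTerm]
  exact parityMixedTerm_mul_of_coprime α two_ne_zero σ d₁ d₂ hk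
    (Nat.prime_two.coprime_iff_not_dvd.mpr hk₂.not_two_dvd_nat)

/-- **Multiplicativity of the unit terms**: `parityUnitTerm (k₁k₂) = parityUnitTerm k₁ · parityUnitTerm k₂` for coprime
`k₁, k₂`. [folklore] -/
theorem parityUnitTerm_mul_of_coprime (α : ℝ) (σ : ℤ) (d₁ d₂ : ℕ) {k₁ k₂ : ℕ} (hk : k₁.Coprime k₂) :
    parityUnitTerm α σ d₁ d₂ (k₁ * k₂) = parityUnitTerm α σ d₁ d₂ k₁ * parityUnitTerm α σ d₁ d₂ k₂ := by
  rw [parityUnitTerm_eq_parityMixedTerm, parityUnitTerm_eq_parityMixedTerm, parityUnitTerm_eq_parityMixedTerm]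
  exact parityMixedTerm_mul_of_coprime α one_ne_zero σ d₁ d₂ hk (Nat.coprime_one_left k₂)

/-! ### The unit term in closed form -/

/-- `c_q(h u) = c_q(h)` for `(q, |u|) = 1` (Kluyver's form only sees the divisors of `q` dividing `h`). [folklore] -/
theorem ramanujanSum_mul_of_coprime_right {q : ℕ} {u : ℤ} (hu : q.Coprime u.natAbs) (h : ℤ) :
    ramanujanSum q (h * u) = ramanujanSum q h := by
  rw [ramanujanSum_eq_ramanujanDivisorSum, ramanujanSum_eq_ramanujanDivisorSum, Int.natAbs_mul,
    ramanujanDivisorSum_apply, ramanujanDivisorSum_apply]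
  congr 1
  refine Finset.sum_congr rfl fun x hx => ?_
  have hx2 : x.2 ∣ q := by
    obtain ⟨hq, -⟩ := Nat.mem_divisorsAntidiagonal.mp hx
    exact ⟨x.1, by rw [mul_comm]; exact hq.symm⟩
  have hcop : x.2.Coprime u.natAbs := hu.coprime_dvd_left hx2
  congr 1
  by_cases h1 : x.2 ∣ h.natAbs
  · rw [if_pos h1, if_pos (dvd_mul_of_dvd_left h1 _)]
  · rw [if_neg h1, if_neg (fun h2 => h1 (hcop.dvd_of_dvd_mul_right h2))]

/-- The modulus-one local factor at `h u` equals that at `h` when `(u, k) = 1`. [folklore] -/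
theorem classLocalFactor_one_mul_unit (α : ℝ) (r : ℕ) {k : ℕ} {u : ℤ} (hu : k.Coprime u.natAbs) (h : ℤ) :
    classLocalFactor α 1 r k (h * u) = classLocalFactor α 1 r k h := by
  rcases eq_or_ne k 0 with rfl | hk
  · simp [classLocalFactor]
  rw [classLocalFactor_of_coprime α hk one_ne_zero (Nat.coprime_one_right k) (r := r) (Nat.coprime_one_right r),
    classLocalFactor_of_coprime α hk one_ne_zero (Nat.coprime_one_right k) (r := r) (Nat.coprime_one_right r)]
  congr 1
  refine Finset.sum_congr rfl fun g hg => ?_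
  rw [ramanujanSum_mul_of_coprime_right
    (hu.coprime_dvd_left (Nat.div_dvd_of_dvd (Nat.dvd_of_mem_divisors hg)))]

/-- **The unit term in closed form.** For `σ = ±1` and `k ≥ 1`:
`parityUnitTerm k = φ(k) · Λ(k; d₁) Λ(k; d₂) G_α(k)` with `Λ(k; d) = classLocalFactor α 1 0 k d` and `G_α = localG`
(the unit `a` and the sign are absorbed by `classLocalFactor_one_mul_unit`, `conj G_α(k) = G_α(k)`). [folklore] -/
theorem parityUnitTerm_eq (α : ℝ) {σ : ℤ} (hσ : σ = 1 ∨ σ = -1) (d₁ d₂ : ℕ) {k : ℕ} (hk : k ≠ 0) :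
    parityUnitTerm α σ d₁ d₂ k =
      (k.totient : ℂ) * (classLocalFactor α 1 0 k d₁ * classLocalFactor α 1 0 k d₂ * (localG α k : ℂ)) := by
  have hσ1 : σ.natAbs = 1 := by rcases hσ with rfl | rfl <;> rfl
  have hC : ∀ a ∈ (Finset.range k).filter (Nat.Coprime k),
      classLocalFactor α 1 0 k (d₁ * a) * classLocalFactor α 1 0 k (σ * (d₂ * a)) *
        starRingEnd ℂ (classLocalFactor α 1 0 k a) =
      classLocalFactor α 1 0 k d₁ * classLocalFactor α 1 0 k d₂ * (localG α k : ℂ) := by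
    intro a ha
    obtain ⟨-, hka⟩ := Finset.mem_filter.mp ha
    have hu1 : k.Coprime (a : ℤ).natAbs := by simpa using hka
    have hu2 : k.Coprime ((a : ℤ) * σ).natAbs := by rw [Int.natAbs_mul, hσ1, mul_one]; simpa using hka
    rw [classLocalFactor_one_mul_unit α 0 hu1, show σ * ((d₂ : ℤ) * a) = d₂ * (a * σ) by ring,
      classLocalFactor_one_mul_unit α 0 hu2, classLocalFactor_one_eq_localG α 0 hk hka.symm, Complex.conj_ofReal]
  unfold parityUnitTerm
  rw [Finset.sum_congr rfl hC, Finset.sum_const, nsmul_eq_mul, Nat.totient_eq_card_coprime]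

end SmoothArcs

end Literature.NumberTheory.Sieve

end
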